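import Mathlib
import Summits.AtomisticToContinuum.FouriersLaw.Theses.JunctionLocality
import Literature.Barriers.AtomisticToContinuum.HarmonicCrystalBallistic
import Literature.MathematicalPhysics.KineticTheory.HarmonicChainNESS
import Literature.MathematicalPhysics.KineticTheory.HarmonicChainFlux

/-!
# `JunctionLocality.HarmonicCalibration` — proved

Item `stmt-AtomisticToContinuum-11753` (support, route `JunctionLocality`, sub-problem `FouriersLaw`):
the sign/normalisation regression test of the route at the integrable corner. For the pinned
HARMONIC chain `pinnedChain ω₂ 0 0 γ` (`ω₂, γ > 0`) the Gaussian measures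
`harmonicNESS ω₂ γ N T_L T_R` (`HarmonicChainNESS.lean`) form a steady-state family for all `N` and
all `T_L, T_R > 0`, along which, at every `T > 0`:

* the finite-`N` response limits exist and equal `D_N = (N - 1) · fluxCoeff ω₂ γ N` — every proper
  bond carries the mean current `fluxCoeff ω₂ γ N · (T_L - T_R)`
  (`integral_bondCurrent_harmonicNESS_eq_fluxCoeff'`), the last site carries none, so the
  difference quotient `totalCurrent(μ_{N, T+δ/2, T-δ/2})/δ` is CONSTANT `= D_N` on `0 < |δ| < 2T`;
* `D_N > 0` for `N ≥ 2`, because the closed form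
  `fluxCoeff ω₂ γ N = γ/(2(1+γ²)) · (r + r^{2N-2})/(1 + r^{2N-1})` (`fluxCoeff_eq`, `0 < r < 1`)
  is bounded below by `fluxLimit ω₂ γ / 2 = γ r/(4(1+γ²)) > 0`;
* the resistances `R_N = (N-1)/D_N = 1/fluxCoeff ω₂ γ N ≤ 2/fluxLimit ω₂ γ` are BOUNDED, hence
  two-sided junction locality `|R_{N+M} - R_N - R_M| ≤ 3 · (2/fluxLimit ω₂ γ)`.

So the ballistic member satisfies clause (A) of the route and violates exactly (B), as it must.
Sources: Bonetto–Lebowitz–Rey-Bellet 2000 §6.2 (Gaussian NESS of the harmonic chain);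
Roy–Dhar 2008 §2 eq. (2.8) (the flux coefficient); Nakazawa 1970. All engines are PROVED tree
facts (`HarmonicChainNESS.lean`, `HarmonicChainFlux.lean`, `HarmonicCrystalBallistic.lean`); no
named fact is assumed.
-/

noncomputable section

open MeasureTheory Filter Topology

namespace Summit.AtomisticToContinuum.FouriersLaw.Theorems.JunctionLocality

open Literature.MathematicalPhysics.KineticTheory.HeatConduction

variable {ω₂ γ : ℝ}

/-- **Uniform lower bound on the flux coefficient**: `fluxLimit ω₂ γ / 2 ≤ fluxCoeff ω₂ γ N` for
`N ≥ 2`, i.e. `γ r/(4(1+γ²)) ≤ γ/(2(1+γ²)) · (r + r^{2N-2})/(1 + r^{2N-1})`, from `0 < r < 1`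
(numerator `≥ r`, denominator `≤ 2`). [cite: RoyDhar2008, §2 eq. (2.8)] -/
theorem fluxLimit_div_two_le_fluxCoeff (hω : 0 < ω₂) (hγ : 0 < γ) {N : ℕ} (hN : 1 < N) :
    fluxLimit ω₂ γ / 2 ≤ fluxCoeff ω₂ γ N := by
  have hr := rootR_pos hω hγ
  have hr1 := rootR_lt_one hω hγ
  rw [fluxCoeff_eq hω hγ hN]
  unfold fluxLimit
  set r := rootR ω₂ γ with hr'
  have ha : 0 ≤ r ^ (2 * N - 2) := pow_nonneg hr.le _
  have hb : r ^ (2 * N - 1) ≤ 1 := pow_le_one₀ hr.le hr1.le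
  have hb0 : 0 ≤ r ^ (2 * N - 1) := pow_nonneg hr.le _
  have key : r / 2 ≤ (r + r ^ (2 * N - 2)) / (1 + r ^ (2 * N - 1)) := by
    rw [div_le_div_iff₀ (by norm_num) (by positivity)]
    nlinarith [mul_le_mul_of_nonneg_left hb hr.le]
  calc γ * r / (2 * (1 + γ ^ 2)) / 2 = γ / (2 * (1 + γ ^ 2)) * (r / 2) := by ring
    _ ≤ γ / (2 * (1 + γ ^ 2)) * ((r + r ^ (2 * N - 2)) / (1 + r ^ (2 * N - 1))) :=
        mul_le_mul_of_nonneg_left key (by positivity)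

/-- **The flux coefficient is positive**: `0 < fluxCoeff ω₂ γ N` for `N ≥ 2` (`ω₂, γ > 0`).
[cite: RoyDhar2008, §2 eq. (2.8)] -/
theorem fluxCoeff_pos (hω : 0 < ω₂) (hγ : 0 < γ) {N : ℕ} (hN : 1 < N) : 0 < fluxCoeff ω₂ γ N :=
  lt_of_lt_of_le (half_pos (fluxLimit_pos hω hγ)) (fluxLimit_div_two_le_fluxCoeff hω hγ hN)

/-- **The harmonic resistances are bounded**: `1 / fluxCoeff ω₂ γ N ≤ 2 / fluxLimit ω₂ γ` for
`N ≥ 2`. [folklore] -/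
theorem one_div_fluxCoeff_le (hω : 0 < ω₂) (hγ : 0 < γ) {N : ℕ} (hN : 1 < N) :
    1 / fluxCoeff ω₂ γ N ≤ 2 / fluxLimit ω₂ γ := by
  have h := one_div_le_one_div_of_le (half_pos (fluxLimit_pos hω hγ))
    (fluxLimit_div_two_le_fluxCoeff hω hγ hN)
  rwa [one_div_div] at h

/-- **Total current of the Gaussian NESS**: for `ω₂, γ > 0`, every `N` and all `T_L, T_R > 0`,
`totalCurrent (harmonicNESS ω₂ γ N T_L T_R) = (N - 1) · fluxCoeff ω₂ γ N · (T_L - T_R)` — the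
`N - 1` proper bonds each carry `fluxCoeff ω₂ γ N · (T_L - T_R)` and the last site carries no bond
current (for `N = 0` both sides vanish: empty sum, and `fluxCoeff ω₂ γ 0 = 0`).
[cite: BonettoLebowitzReyBellet2000, §6.2] -/
theorem totalCurrent_harmonicNESS (hω : 0 < ω₂) (hγ : 0 < γ) (N : ℕ) {T_L T_R : ℝ}
    (hL : 0 < T_L) (hR : 0 < T_R) :
    (pinnedChain ω₂ 0 0 γ).totalCurrent (harmonicNESS ω₂ γ N T_L T_R) =
      ((N : ℝ) - 1) * fluxCoeff ω₂ γ N * (T_L - T_R) := by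
  cases N with
  | zero =>
    have h0 : fluxCoeff ω₂ γ 0 = 0 := by simp [fluxCoeff]
    simp [OscillatorChain.totalCurrent, h0]
  | succ M =>
    rw [(pinnedChain ω₂ 0 0 γ).totalCurrent_eq_of_forall (harmonicNESS ω₂ γ (M + 1) T_L T_R)
      (fluxCoeff ω₂ γ (M + 1) * (T_L - T_R))
      (fun i hi => integral_bondCurrent_harmonicNESS_eq_fluxCoeff' hω hγ hL hR i hi)]
    push_cast
    ring

/-- **`JunctionLocality.HarmonicCalibration`, PROVED** (item stmt-AtomisticToContinuum-11753): for the
pinned harmonic chain `pinnedChain ω₂ 0 0 γ` (`ω₂, γ > 0`) the Gaussian steady-state family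
`harmonicNESS ω₂ γ` is a steady state for all `N` and `T_L, T_R > 0`, and at every `T > 0` the
response limits exist with `D_N = (N-1) · fluxCoeff ω₂ γ N`, `D_N > 0` for `N ≥ 2`, the resistances
`R_N = (N-1)/D_N = 1/fluxCoeff ω₂ γ N` satisfy two-sided junction locality with
`C = 3 · (2/fluxLimit ω₂ γ)` and are bounded by `B = 2/fluxLimit ω₂ γ`.
[cite: BonettoLebowitzReyBellet2000, §6.2] -/
theorem harmonicCalibration_proof :
    Summit.AtomisticToContinuum.FouriersLaw.Theses.JunctionLocality.HarmonicCalibration := by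
  unfold Summit.AtomisticToContinuum.FouriersLaw.Theses.JunctionLocality.HarmonicCalibration
  intro ω₂ γ hω hγ
  refine ⟨harmonicNESS ω₂ γ, fun N T_L T_R hL hR => isSteadyState_harmonicNESS hω hγ N hL hR,
    fun T hT => ?_⟩
  -- (1) the response limit: the difference quotient is eventually constant `= (N-1) c_N`
  have h1 : ∀ N : ℕ, Tendsto (fun δ : ℝ =>
      (pinnedChain ω₂ 0 0 γ).totalCurrent (harmonicNESS ω₂ γ N (T + δ / 2) (T - δ / 2)) / δ)
      (𝓝[≠] 0) (𝓝 (((N : ℝ) - 1) * fluxCoeff ω₂ γ N)) := by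
    intro N
    have hconst : ∀ᶠ δ in 𝓝[≠] (0 : ℝ),
        (pinnedChain ω₂ 0 0 γ).totalCurrent (harmonicNESS ω₂ γ N (T + δ / 2) (T - δ / 2)) / δ =
          ((N : ℝ) - 1) * fluxCoeff ω₂ γ N := by
      have h2 : ∀ᶠ δ in 𝓝 (0 : ℝ), δ < 2 * T := eventually_lt_nhds (by linarith)
      have h2' : ∀ᶠ δ in 𝓝 (0 : ℝ), -(2 * T) < δ := eventually_gt_nhds (by linarith)
      have hne : ∀ᶠ δ in 𝓝[≠] (0 : ℝ), δ ≠ 0 := eventually_mem_nhdsWithin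
      filter_upwards [mem_nhdsWithin_of_mem_nhds h2, mem_nhdsWithin_of_mem_nhds h2', hne]
        with δ hlt hgt hδ
      have ha : 0 < T + δ / 2 := by linarith
      have hb : 0 < T - δ / 2 := by linarith
      have e : T + δ / 2 - (T - δ / 2) = δ := by ring
      rw [totalCurrent_harmonicNESS hω hγ N ha hb, e, mul_div_assoc, div_self hδ, mul_one]
    exact tendsto_const_nhds.congr' (hconst.mono fun δ hδ => hδ.symm)
  -- (2) positivity of `D_N` for `N ≥ 2`
  have h2 : ∀ N : ℕ, 2 ≤ N → 0 < ((N : ℝ) - 1) * fluxCoeff ω₂ γ N := by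
    intro N hN
    have hN2 : (2 : ℝ) ≤ N := by exact_mod_cast hN
    exact mul_pos (by linarith) (fluxCoeff_pos hω hγ (by omega))
  -- the resistances `R_N = (N-1)/D_N = 1/c_N`
  have hR : ∀ N : ℕ, 2 ≤ N →
      ((N : ℝ) - 1) / (((N : ℝ) - 1) * fluxCoeff ω₂ γ N) = 1 / fluxCoeff ω₂ γ N := by
    intro N hN
    have hN2 : (2 : ℝ) ≤ N := by exact_mod_cast hN
    rw [div_mul_eq_div_div, div_self (by linarith)]
  -- (3) two-sided junction locality with `C = 3 B`
  have h3 : ∃ C : ℝ, ∀ N M : ℕ, 2 ≤ N → 2 ≤ M →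
      |((N : ℝ) + (M : ℝ) - 1) / ((((N + M : ℕ) : ℝ) - 1) * fluxCoeff ω₂ γ (N + M)) -
        ((N : ℝ) - 1) / (((N : ℝ) - 1) * fluxCoeff ω₂ γ N) -
        ((M : ℝ) - 1) / (((M : ℝ) - 1) * fluxCoeff ω₂ γ M)| ≤ C := by
    refine ⟨3 * (2 / fluxLimit ω₂ γ), fun N M hN hM => ?_⟩
    have hNM := hR (N + M) (by omega)
    rw [Nat.cast_add] at hNM
    rw [Nat.cast_add, hNM, hR N hN, hR M hM]
    have bN := one_div_fluxCoeff_le hω hγ (show 1 < N by omega)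
    have bM := one_div_fluxCoeff_le hω hγ (show 1 < M by omega)
    have bNM := one_div_fluxCoeff_le hω hγ (show 1 < N + M by omega)
    have pN : 0 < 1 / fluxCoeff ω₂ γ N := one_div_pos.mpr (fluxCoeff_pos hω hγ (by omega))
    have pM : 0 < 1 / fluxCoeff ω₂ γ M := one_div_pos.mpr (fluxCoeff_pos hω hγ (by omega))
    have pNM : 0 < 1 / fluxCoeff ω₂ γ (N + M) :=
      one_div_pos.mpr (fluxCoeff_pos hω hγ (by omega))
    rw [abs_le]
    constructor <;> linarith
  -- (4) bounded resistances
  have h4 : ∃ B : ℝ, ∀ N : ℕ, 2 ≤ N →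
      ((N : ℝ) - 1) / (((N : ℝ) - 1) * fluxCoeff ω₂ γ N) ≤ B := by
    refine ⟨2 / fluxLimit ω₂ γ, fun N hN => ?_⟩
    rw [hR N hN]
    exact one_div_fluxCoeff_le hω hγ (by omega)
  exact ⟨fun N => ((N : ℝ) - 1) * fluxCoeff ω₂ γ N, h1, h2, h3, h4⟩

end Summit.AtomisticToContinuum.FouriersLaw.Theorems.JunctionLocality

end
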